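import Summits.Ventures.PercRepro.S1CFCapsFourThree
import Summits.Ventures.PercRepro.S1CFGFourTwo

/-!
# PercRepro — THE CONTAINMENT ARGUMENT FOR TWO OR THREE DEPENDENT PAIRS ON `n ≥ 11` POINTS (p1, gen 38; stage 3 of the
cap `D₄` for every `n`)

The `12`-point theorems of S1CFCapsFourThree (p1, gen 37) for every ground set of `n ≥ 11` points:
* **`not_isCircuit_subset_partnered`** (`n ≥ 9`) — a short circuit all of whose points have parallel partners is
  impossible (the partner injection of LEMMA K: `2|C| ≤ 8 < n` points of nullity `|C| + 1 ≥ 4` inside `cl C`);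
* **`ncard_dep_four_le_of_two_le_of_le_three`** — `2 ≤ D₂ ≤ 3 ⇒ D₄ ≤ 3 · C(n − 2, 2) + 5 · (n − 3) + 12`: the set `U`
  of partnered points has nullity exactly `2` and `≤ 4` points (a nullity-`3` `U` with a short circuit `C₁ ⊄ U` would
  make `U ∪ C₁ = E` on `≤ 10 < n` points), `V = U ∪ C₁` has nullity `3` on `≤ 8 ≤ n − 3` points, every short circuit
  lies inside `V` or contains `E ∖ V` (the dichotomy; at most `C(|V|, k − |E ∖ V|)` such `k`-sets: `1` at `k = 3`,
  `≤ 8` at `k = 4` — `|E ∖ V| = 3` happens only at `n = 11`), and two parallel substitutions lift the counts from the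
  nullity-`1` set `V ∖ {a', b'}`: `c₃ ≤ 4 + 1`, `c₄ ≤ 4 + 8`;
The assembly over the five cases is S1CFGFourAll. Nothing about any cell is claimed. Axioms: standard.
-/

open scoped Matroid

namespace PercRepro

namespace S1CFG

open Set S1CF

variable {α : Type}

/-- **A short circuit all of whose points have parallel partners is impossible** (nullity `4`, `n ≥ 9` points). -/
theorem not_isCircuit_subset_partnered (M : Matroid α) [M.Finite] (hL : ∀ e ∈ M.E, ¬ M.IsLoop e)
    (hK : ∀ e, ¬ M.IsColoop e) (hd : M.E.encard = M.eRank + ((4 : ℕ) : ℕ∞)) (hn : 9 ≤ M.E.ncard)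
    {C : Set α} (hC : M.IsCircuit C) (hC3 : 3 ≤ C.ncard) (hC4 : C.ncard ≤ 4)
    (hpart : ∀ c ∈ C, ∃ v ∈ M.E, v ≠ c ∧ M.Dep {c, v}) : False := by
  classical
  have hEfin := M.ground_finite
  have hCE : C ⊆ M.E := hC.subset_ground
  have hCfin : C.Finite := hEfin.subset hCE
  haveI : Nonempty α := ⟨Classical.choice (by
    have : C.Nonempty := by rw [← Set.ncard_pos hCfin]; omega
    exact ⟨this.some⟩)⟩
  have hpart' : ∀ c ∈ C, ∃ v, v ∈ M.E ∧ v ≠ c ∧ M.Dep {c, v} := fun c hc => by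
    obtain ⟨v, hvE, hvc, hdep⟩ := hpart c hc
    exact ⟨v, hvE, hvc, hdep⟩
  choose! p hp using hpart'
  have hpC : ∀ c ∈ C, p c ∉ C := by
    intro c hc hpc
    obtain ⟨-, hne', hdep⟩ := hp c hc
    exact not_dep_pair_of_isCircuit M hC (by
      intro w hw; rcases hw with rfl | rfl
      · exact hc
      · exact hpc) (Set.ncard_pair (Ne.symm hne')) hC3 hdep
  have hpcl : ∀ c ∈ C, p c ∈ M.closure C := by
    intro c hc
    obtain ⟨-, -, hdep⟩ := hp c hc
    have hcE : c ∈ M.E := hCE hc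
    have := mem_closure_singleton_of_dep_pair M hcE (hL c hcE) hdep
    exact M.closure_subset_closure (Set.singleton_subset_iff.2 hc) this
  have hinj : Set.InjOn p C := by
    intro c hc c' hc' hpp
    by_contra hcc
    obtain ⟨hvE, -, hdep⟩ := hp c hc
    obtain ⟨-, -, hdep'⟩ := hp c' hc'
    have hLv := hL (p c) hvE
    have h1 : c ∈ M.closure {p c} :=
      mem_closure_singleton_of_dep_pair M hvE hLv (by rwa [Set.pair_comm])
    have h2 : c' ∈ M.closure {p c} := by
      rw [hpp]
      exact mem_closure_singleton_of_dep_pair M (by rw [← hpp]; exact hvE) (by rw [← hpp]; exact hLv)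
        (by rwa [Set.pair_comm])
    have hsub : ({c, c'} : Set α) ⊆ M.closure {p c} := by
      intro w hw; rcases hw with rfl | rfl
      · exact h1
      · exact h2
    have hr : M.eRk {c, c'} ≤ 1 := eRk_le_one_of_subset_closure_singleton M hsub
    have hdep2 : M.Dep {c, c'} := by
      have hfin : ({c, c'} : Set α).Finite := Set.toFinite _
      rw [← Matroid.eRk_lt_encard_iff_dep_of_finite hfin (by
        intro w hw; rcases hw with rfl | rfl
        · exact hCE hc
        · exact hCE hc')]
      rw [Set.encard_pair hcc]
      exact lt_of_le_of_lt hr (by norm_num)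
    exact not_dep_pair_of_isCircuit M hC (by
      intro w hw; rcases hw with rfl | rfl
      · exact hc
      · exact hc') (Set.ncard_pair hcc) hC3 hdep2
  set V := C ∪ p '' C with hVdef
  have hVcl : V ⊆ M.closure C := union_subset (M.subset_closure C hCE) (by
    rintro _ ⟨c, hc, rfl⟩; exact hpcl c hc)
  have hVE : V ⊆ M.E := hVcl.trans (M.closure_subset_ground C)
  have hdisj : Disjoint C (p '' C) := by
    rw [Set.disjoint_left]
    rintro w hw ⟨c, hc, rfl⟩
    exact hpC c hc hw
  have hVcard : V.ncard = 2 * C.ncard := by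
    rw [hVdef, Set.ncard_union_eq hdisj hCfin (hCfin.image p), hinj.ncard_image]; ring
  have hVrk : (M.eRk V).toNat + 1 ≤ C.ncard := by
    have h1 : M.eRk V ≤ M.eRk C := by
      calc M.eRk V ≤ M.eRk (M.closure C) := M.eRk_mono hVcl
        _ = M.eRk C := M.eRk_closure_eq C
    have h2 := hC.eRk_add_one_eq
    rw [← S1.coe_toNat_eRk M hVE, ← S1.coe_toNat_eRk M hCE] at h1
    rw [← S1.coe_toNat_eRk M hCE, ← hCfin.cast_ncard_eq] at h2
    have h1' : (M.eRk V).toNat ≤ (M.eRk C).toNat := by exact_mod_cast h1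
    have h2' : (M.eRk C).toNat + 1 = C.ncard := by exact_mod_cast h2
    omega
  have hVne : V ≠ M.E := by
    intro h; rw [h] at hVcard; omega
  have := ncard_add_one_le_eRk_toNat_add_of_ssubset M hd hK hVE hVne
  omega

/-- **`2 ≤ D₂ ≤ 3 ⇒ D₄ ≤ 3 · C(n − 2, 2) + 5 · (n − 3) + 12`** (`n ≥ 11`): the containment argument (`c₃ ≤ 5`,
`c₄ ≤ 12`). -/
theorem ncard_dep_four_le_of_two_le_of_le_three (M : Matroid α) [M.Finite] (hL : ∀ e ∈ M.E, ¬ M.IsLoop e)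
    (hK : ∀ e, ¬ M.IsColoop e) (hd : M.E.encard = M.eRank + ((4 : ℕ) : ℕ∞)) (hn : 11 ≤ M.E.ncard)
    (h2 : 2 ≤ {P : Set α | P ⊆ M.E ∧ P.ncard = 2 ∧ M.Dep P}.ncard)
    (h3 : {P : Set α | P ⊆ M.E ∧ P.ncard = 2 ∧ M.Dep P}.ncard ≤ 3) :
    {X : Set α | X ⊆ M.E ∧ X.ncard = 4 ∧ M.Dep X}.ncard ≤
      3 * (M.E.ncard - 2).choose 2 + 5 * (M.E.ncard - 3) + 12 := by
  classical
  have hEfin := M.ground_finite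
  have hs := ncard_dep_four_le_split_general M
  have hs2 : (M.E.ncard - 2).choose 2 * {P : Set α | P ⊆ M.E ∧ P.ncard = 2 ∧ M.Dep P}.ncard ≤
      (M.E.ncard - 2).choose 2 * 3 := Nat.mul_le_mul_left _ h3
  -- the points with a partner
  set U := {u ∈ M.E | ∃ v ∈ M.E, v ≠ u ∧ M.Dep {u, v}} with hUdef
  have hUE : U ⊆ M.E := fun u hu => hu.1
  have hUfin : U.Finite := hEfin.subset hUE
  have hpairs : {P : Set α | P ⊆ M.E ∧ P.ncard = 2 ∧ M.Dep P} ⊆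
      {P : Set α | P ⊆ U ∧ P.ncard = 2 ∧ M.Dep (∅ ∪ P) ∧ ∀ Q, Q ⊂ P → M.Indep (∅ ∪ Q)} := by
    intro P hP
    obtain ⟨hPE, hP2, hPdep⟩ := hP
    refine ⟨?_, hP2, by simpa using hPdep, fun Q hQ => by simpa using indep_of_ssubset_pair M hL hPE hP2 hQ⟩
    intro u huP
    refine ⟨hPE huP, ?_⟩
    obtain ⟨a, b, hab, rfl⟩ := Set.ncard_eq_two.1 hP2
    rcases huP with rfl | rfl
    · exact ⟨b, hPE (by simp), Ne.symm hab, hPdep⟩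
    · exact ⟨a, hPE (by simp), hab, by rwa [Set.pair_comm]⟩
  -- nullity of `U` is `≥ 2`
  have hnull2 : (M.eRk U).toNat + 2 ≤ U.ncard := by
    by_contra hlt
    push Not at hlt
    have hν : (∅ ∪ U).ncard ≤ (M.eRk (∅ ∪ U)).toNat + 1 := by simpa using (by omega : U.ncard ≤ (M.eRk U).toNat + 1)
    have := (Set.ncard_le_ncard hpairs (relCircuits_finite M ∅ hUE 2)).trans
      (ncard_relCircuits_le M 2 (by norm_num) 1 ∅ U (empty_subset _) hUE
        (Set.disjoint_left.2 fun a ha => absurd ha (Set.notMem_empty a)) M.empty_indep hν)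
    norm_num at this
    omega
  have hpartU : ∀ y ∈ U, ∃ z ∈ U, z ≠ y ∧ M.Dep {y, z} := by
    intro y hy
    obtain ⟨v, hvE, hvy, hdep⟩ := hy.2
    exact ⟨v, ⟨hvE, y, hy.1, Ne.symm hvy, by rwa [Set.pair_comm]⟩, hvy, hdep⟩
  have hcover := two_mul_eRk_toNat_le_ncard_of_partner M hL U.ncard U hUE rfl hpartU
  have hUne : U ≠ M.E := by
    intro h
    rw [h, eRk_ground_toNat_eq M hd] at hcover
    omega
  have hUnull := ncard_add_one_le_eRk_toNat_add_of_ssubset M hd hK hUE hUne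
  -- no short circuit: `D₄ ≤ C(n − 2, 2) · D₂`
  by_cases hcirc : ∃ C, C ⊆ M.E ∧ M.IsCircuit C ∧ 3 ≤ C.ncard ∧ C.ncard ≤ 4
  swap
  · push Not at hcirc
    have hT0 : {C : Set α | C ⊆ M.E ∧ M.IsCircuit C ∧ C.ncard = 3}.ncard = 0 := by
      rw [Set.ncard_eq_zero (hEfin.finite_subsets.subset (fun X hX => hX.1)), Set.eq_empty_iff_forall_notMem]
      intro C hC
      obtain ⟨hCE, hCc, hC3⟩ := hC
      have := hcirc C hCE hCc (by omega)
      omega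
    have hC0 : {C : Set α | C ⊆ M.E ∧ M.IsCircuit C ∧ C.ncard = 4}.ncard = 0 := by
      rw [Set.ncard_eq_zero (hEfin.finite_subsets.subset (fun X hX => hX.1)), Set.eq_empty_iff_forall_notMem]
      intro C hC
      obtain ⟨hCE, hCc, hC4⟩ := hC
      have := hcirc C hCE hCc (by omega)
      omega
    rw [hT0, hC0] at hs
    omega
  obtain ⟨C₁, hC₁E, hC₁c, hC₁3, hC₁4⟩ := hcirc
  -- `C₁ ⊄ U`
  have hC₁U : ¬ C₁ ⊆ U := by
    intro hsub
    exact not_isCircuit_subset_partnered M hL hK hd (by omega) hC₁c hC₁3 hC₁4 (fun c hc => (hsub hc).2)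
  have hstep := S1.nullity_step M hUE hC₁c hC₁U
  set V := U ∪ C₁ with hVdef
  have hVE : V ⊆ M.E := union_subset hUE hC₁E
  have hVfin : V.Finite := hEfin.subset hVE
  have hVcard : V.ncard ≤ U.ncard + C₁.ncard := Set.ncard_union_le U C₁
  -- nullity of `U` is exactly `2` and `|U| ≤ 4`
  have hU4 : U.ncard ≤ 4 := by
    rcases Nat.lt_or_ge U.ncard ((M.eRk U).toNat + 3) with hlt | hge
    · omega
    · exfalso
      have hVne : V ≠ M.E := by
        intro h
        rw [h] at hVcard
        omega
      have := ncard_add_one_le_eRk_toNat_add_of_ssubset M hd hK hVE hVne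
      omega
  have hVne : V ≠ M.E := by
    intro h; rw [h] at hVcard; omega
  have hVnull := ncard_add_one_le_eRk_toNat_add_of_ssubset M hd hK hVE hVne
  have hV3 : (M.eRk V).toNat + 3 ≤ V.ncard := by omega
  -- every short circuit lies inside `V` or contains `E ∖ V` (then it is one of `≤ C(|V|, k − |E ∖ V|)` sets)
  have hEV : M.E \ (M.E \ V) = V := Set.sdiff_sdiff_cancel_left hVE
  have hEVcard : (M.E \ V).ncard + V.ncard = M.E.ncard := Set.ncard_sdiff_add_ncard_of_subset hVE hEfin
  have hshort : ∀ k, {C : Set α | C ⊆ M.E ∧ M.IsCircuit C ∧ C.ncard = k}.ncard ≤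
      {C : Set α | C ⊆ V ∧ M.IsCircuit C ∧ C.ncard = k}.ncard + V.ncard.choose (k - (M.E \ V).ncard) := by
    intro k
    have hsub : {C : Set α | C ⊆ M.E ∧ M.IsCircuit C ∧ C.ncard = k} ⊆
        {C : Set α | C ⊆ V ∧ M.IsCircuit C ∧ C.ncard = k} ∪
          {X : Set α | X ⊆ M.E ∧ X.ncard = k ∧ M.E \ V ⊆ X} := by
      intro C hC
      obtain ⟨hCE, hCc, hCk⟩ := hC
      rcases isCircuit_subset_or_compl_subset M hK hd hVE hV3 hCc with hCV | hcompl
      · exact Or.inl ⟨hCV, hCc, hCk⟩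
      · exact Or.inr ⟨hCE, hCk, hcompl⟩
    have hsup := ncard_supersets_le (E := M.E) (P := M.E \ V) hEfin k
    rw [hEV] at hsup
    calc {C : Set α | C ⊆ M.E ∧ M.IsCircuit C ∧ C.ncard = k}.ncard
        ≤ ({C : Set α | C ⊆ V ∧ M.IsCircuit C ∧ C.ncard = k} ∪
            {X : Set α | X ⊆ M.E ∧ X.ncard = k ∧ M.E \ V ⊆ X}).ncard :=
          Set.ncard_le_ncard hsub ((hEfin.finite_subsets.subset (fun C hC => hC.1.trans hVE)).union
            (hEfin.finite_subsets.subset (fun X hX => hX.1)))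
      _ ≤ {C : Set α | C ⊆ V ∧ M.IsCircuit C ∧ C.ncard = k}.ncard +
            {X : Set α | X ⊆ M.E ∧ X.ncard = k ∧ M.E \ V ⊆ X}.ncard := Set.ncard_union_le _ _
      _ ≤ _ := by gcongr
  -- `|E ∖ V| ≥ 3`, so the extra terms are `C(|V|, 0) = 1` at `k = 3` and `≤ max (1, |V|) ≤ 8` at `k = 4`
  have hV8 : V.ncard ≤ 8 := by omega
  have hextra3 : V.ncard.choose (3 - (M.E \ V).ncard) = 1 := by
    rw [show 3 - (M.E \ V).ncard = 0 by omega, Nat.choose_zero_right]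
  have hextra4 : V.ncard.choose (4 - (M.E \ V).ncard) ≤ 8 := by
    rcases Nat.lt_or_ge (M.E \ V).ncard 4 with hlt | hge
    · rw [show 4 - (M.E \ V).ncard = 1 by omega, Nat.choose_one_right]; exact hV8
    · rw [show 4 - (M.E \ V).ncard = 0 by omega, Nat.choose_zero_right]; omega
  -- two dependent pairs for the liftings
  obtain ⟨P₁, hP₁⟩ : {P : Set α | P ⊆ M.E ∧ P.ncard = 2 ∧ M.Dep P}.Nonempty := by
    rw [← Set.ncard_pos (hEfin.finite_subsets.subset (fun P hP => hP.1))]; omega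
  obtain ⟨hP₁E, hP₁2, hP₁dep⟩ := hP₁
  obtain ⟨P₂, hP₂, hP₂ne⟩ := Set.exists_ne_of_one_lt_ncard (by omega : 1 < {P : Set α | P ⊆ M.E ∧ P.ncard = 2 ∧ M.Dep P}.ncard) P₁
  obtain ⟨hP₂E, hP₂2, hP₂dep⟩ := hP₂
  obtain ⟨a, a', haa', rfl⟩ := Set.ncard_eq_two.1 hP₁2
  have haE : a ∈ M.E := hP₁E (by simp)
  have ha'E : a' ∈ M.E := hP₁E (by simp)
  have ha'cl : a' ∈ M.closure {a} := mem_closure_singleton_of_dep_pair M haE (hL a haE) hP₁dep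
  have haU : a ∈ U := ⟨haE, a', ha'E, Ne.symm haa', hP₁dep⟩
  have ha'U : a' ∈ U := ⟨ha'E, a, haE, haa', by rwa [Set.pair_comm]⟩
  -- a second pair `{b, b'}` with `b' ∉ {a, a'}` and `b ≠ a'`
  obtain ⟨b, b', hbb', hb'P₁, hbE, hb'E, hdep⟩ : ∃ b b' : α, b ≠ b' ∧ b' ∉ ({a, a'} : Set α) ∧ b ∈ M.E ∧ b' ∈ M.E ∧
      M.Dep {b, b'} ∧ b ≠ a' := by
    obtain ⟨c, c', hcc', rfl⟩ := Set.ncard_eq_two.1 hP₂2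
    have hcE : c ∈ M.E := hP₂E (by simp)
    have hc'E : c' ∈ M.E := hP₂E (by simp)
    have hnot : ¬ ({c, c'} : Set α) ⊆ {a, a'} := by
      intro h
      exact hP₂ne (Set.eq_of_subset_of_ncard_le h (by rw [Set.ncard_pair hcc', Set.ncard_pair haa']) (Set.toFinite _))
    -- one of `c, c'` is outside `{a, a'}`; name it `b'` and the other `c₀`
    have key : ∀ b' c₀ : α, b' ≠ c₀ → b' ∈ M.E → c₀ ∈ M.E → M.Dep {c₀, b'} → b' ∉ ({a, a'} : Set α) →
        ∃ b b'' : α, b ≠ b'' ∧ b'' ∉ ({a, a'} : Set α) ∧ b ∈ M.E ∧ b'' ∈ M.E ∧ M.Dep {b, b''} ∧ b ≠ a' := by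
      intro b' c₀ hne hb'E hc₀E hdep hb'P
      by_cases hc₀ : c₀ = a'
      · -- replace `a'` by `a`
        refine ⟨a, b', fun h => hb'P (by rw [← h]; simp), hb'P, haE, hb'E, ?_, haa'⟩
        have hb'cl : b' ∈ M.closure {c₀} := mem_closure_singleton_of_dep_pair M hc₀E (hL c₀ hc₀E) hdep
        rw [hc₀] at hb'cl
        have hcl : M.closure {a'} = M.closure {a} :=
          closure_singleton_eq_of_mem_closure_singleton M haE (hL a haE) ha'cl (hL a' ha'E)
        rw [hcl] at hb'cl
        have hI : M.Indep {a} := indep_singleton_of_not_isLoop M haE (hL a haE)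
        have : M.Dep (insert b' {a}) := by
          rw [hI.insert_dep_iff]
          exact ⟨hb'cl, fun h => hb'P (by rw [Set.mem_singleton_iff.1 h]; simp)⟩
        rwa [Set.pair_comm] at this
      · exact ⟨c₀, b', Ne.symm hne, hb'P, hc₀E, hb'E, hdep, hc₀⟩
    by_cases hcP : c ∈ ({a, a'} : Set α)
    · have hc'P : c' ∉ ({a, a'} : Set α) := fun h => hnot (by
        intro w hw; rcases hw with rfl | rfl; exacts [hcP, h])
      exact key c' c (Ne.symm hcc') hc'E hcE hP₂dep hc'P
    · exact key c c' hcc' hcE hc'E (by rwa [Set.pair_comm]) hcP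
  obtain ⟨hdep, hba'⟩ := hdep
  have hb'U : b' ∈ U := ⟨hb'E, b, hbE, hbb', by rwa [Set.pair_comm]⟩
  have hbU : b ∈ U := ⟨hbE, b', hb'E, Ne.symm hbb', hdep⟩
  have hb'cl : b' ∈ M.closure {b} := mem_closure_singleton_of_dep_pair M hbE (hL b hbE) hdep
  have hb'a : b' ≠ a := fun h => hb'P₁ (by rw [h]; simp)
  have hb'a' : b' ≠ a' := fun h => hb'P₁ (by rw [h]; simp)
  -- the two liftings: `V ∖ {a'}` then `∖ {b'}`, of nullity `1`
  have haV : a ∈ V := Or.inl haU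
  have ha'V : a' ∈ V := Or.inl ha'U
  have hV1 : V \ {a'} ⊆ M.E := sdiff_subset.trans hVE
  have haV1 : a ∈ V \ {a'} := ⟨haV, fun h => haa' (Set.mem_singleton_iff.1 h)⟩
  have hbV1 : b ∈ V \ {a'} := ⟨Or.inl hbU, fun h => hba' (Set.mem_singleton_iff.1 h)⟩
  have hb'V1 : b' ∈ V \ {a'} := ⟨Or.inl hb'U, fun h => hb'a' (Set.mem_singleton_iff.1 h)⟩
  have hV2 : (V \ {a'}) \ {b'} ⊆ M.E := sdiff_subset.trans hV1
  have hrk1 : M.eRk (V \ {a'}) = M.eRk V := eRk_sdiff_singleton_eq_of_parallel M hVE haV haa' ha'cl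
  have hrk2 : M.eRk ((V \ {a'}) \ {b'}) = M.eRk (V \ {a'}) :=
    eRk_sdiff_singleton_eq_of_parallel M hV1 hbV1 hbb' hb'cl
  have hc1 := Set.ncard_sdiff_singleton_add_one ha'V hVfin
  have hc2 := Set.ncard_sdiff_singleton_add_one hb'V1 (hVfin.subset sdiff_subset)
  have hν2 : ((V \ {a'}) \ {b'}).ncard ≤ (M.eRk ((V \ {a'}) \ {b'})).toNat + 1 := by
    rw [hrk2, hrk1]; omega
  have hlift : ∀ k, 3 ≤ k → {C : Set α | C ⊆ V ∧ M.IsCircuit C ∧ C.ncard = k}.ncard ≤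
      4 * {C : Set α | C ⊆ (V \ {a'}) \ {b'} ∧ M.IsCircuit C ∧ C.ncard = k}.ncard := by
    intro k hk
    have h1 := ncard_isCircuit_le_two_mul_sdiff M hL haE ha'E haa' hP₁dep hVE haV hk
    have h2 := ncard_isCircuit_le_two_mul_sdiff M hL hbE hb'E hbb' hdep hV1 hbV1 hk
    omega
  have hin3 := ncard_isCircuit_ncard_eq_le M (ν := 1) (k := 3) (by norm_num) hV2 hν2
  have hin4 := ncard_isCircuit_ncard_eq_le M (ν := 1) (k := 4) (by norm_num) hV2 hν2
  norm_num at hin3 hin4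
  have hc3 := hshort 3
  have hc4 := hshort 4
  rw [hextra3] at hc3
  have hl3 := hlift 3 (by norm_num)
  have hl4 := hlift 4 (by norm_num)
  have hc3' : {C : Set α | C ⊆ M.E ∧ M.IsCircuit C ∧ C.ncard = 3}.ncard ≤ 5 := by omega
  have hc3'' : (M.E.ncard - 3) * {C : Set α | C ⊆ M.E ∧ M.IsCircuit C ∧ C.ncard = 3}.ncard ≤
      (M.E.ncard - 3) * 5 := Nat.mul_le_mul_left _ hc3'
  omega

end S1CFG

end PercRepro
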